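import Mathlib
import HarnessLib
import Summits.QuantumFields.YangMills.Theorems.ComplexCouplingChannelContinuumLegGivenGapPtuDerivativesOneDim

/-!
# `ContinuumLegGivenGap` (stmt-QuantumFields-15828), line `alternating-curvature-arrays`: `stub_ptuDerivatives`, helper 3 — geometric derivative bounds of the building blocks of the normaliser

Support file for the registered stub `stub_ptuDerivatives` (derivative bounds of the Whitney system of
`stub_productToUniform`).  From helper 1 (`ptuDeriv_cut_bound`: `‖Dᵇ ptuCut‖ ≤ (2²² (N+1)²/(a w))ᵇ`, `b ≤ N`) and the
all-orders product Leibniz bound, the GLOBAL geometric bounds (shape `‖Dᵇ f‖ ≤ Kᵇ` for all `b ≤ N`, values in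
`[0,1]`) and the smoothness of the four kinds of terms of `W = near + out + ∑∑ φ*` and of the enlarged bumps `φ̃`:

* §1 tensor bumps on `(ℝ⁴)^p` (each factor composed with a coordinate projection of norm `≤ 1`, `p` factors):
  `φ̃`, `φ*` with `K = p · 2²⁵ (N+1)²/(a d)` (`d = ptuD m p`, ramp `a d/8`);
* §2 the near weight `ptuNear` (plateaus of coordinate DIFFERENCES, a linear map of norm `≤ 2`; `4` coordinates;
  `≤ p²` pairs; two complements `1 - ·`): `K = p² · 2²⁵ (N+1)²/(R a)` (registered anchor `ptuDeriv_near_bound`);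
* §3 the outer weight `ptuOut` (`4p` coordinate plateaus of ramp `aL/8`, one complement): `K = p · 2²⁵ (N+1)²/(a L)`.

Mathlib + helper 1 only; no definitions. [folklore]
-/

set_option autoImplicit false

noncomputable section

open scoped Classical

namespace Summit.QuantumFields.YangMills.Theorems.ContinuumLegGivenGap

open scoped BigOperators ContDiff
open Filter Topology Set
open Summit.QuantumFields.YangMills.Theorems.ContinuumLegGivenGap.AlternatingArrays

/-! ## §1 Tensor bumps -/

/-- The coordinate projections `y ↦ yᵢ` of `(ℝ⁴)^p` (sup norm) have operator norm `≤ 1`. [folklore] -/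
theorem ptuDeriv_norm_piProj_le (p : ℕ) (i : Fin p) :
    ‖(ContinuousLinearMap.proj (R := ℝ) (φ := fun _ : Fin p => EuclideanSpace ℝ (Fin 4)) i)‖ ≤ 1 :=
  ContinuousLinearMap.opNorm_le_bound _ zero_le_one fun y => by
    rw [one_mul]
    exact norm_le_pi_norm y i

/-- **Tensor products of one-point factors with geometric bounds**: smooth, and `‖Dᵇ ∏ᵢ fᵢ(yᵢ)‖ ≤ (p K)ᵇ` for
`b ≤ N`. [folklore] -/
theorem ptuDeriv_tensor_bound {p : ℕ} (f : Fin p → EuclideanSpace ℝ (Fin 4) → ℝ) (hf : ∀ i, ContDiff ℝ ∞ (f i))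
    {K : ℝ} (hK : 0 ≤ K) {N : ℕ} (h : ∀ i, ∀ b ≤ N, ∀ u, ‖iteratedFDeriv ℝ b (f i) u‖ ≤ K ^ b) :
    ContDiff ℝ ∞ (fun y : (Fin p → EuclideanSpace ℝ (Fin 4)) => ∏ i, f i (y i)) ∧
      ∀ b ≤ N, ∀ y, ‖iteratedFDeriv ℝ b (fun y : (Fin p → EuclideanSpace ℝ (Fin 4)) => ∏ i, f i (y i)) y‖ ≤
        ((p : ℝ) * K) ^ b := by
  set g : Fin p → (Fin p → EuclideanSpace ℝ (Fin 4)) → ℝ := fun i =>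
    f i ∘ (ContinuousLinearMap.proj (R := ℝ) (φ := fun _ : Fin p => EuclideanSpace ℝ (Fin 4)) i) with hg
  have hfun : (fun y : (Fin p → EuclideanSpace ℝ (Fin 4)) => ∏ i, f i (y i)) = fun y => ∏ i ∈ Finset.univ, g i y := by
    funext y; rfl
  have hgc : ∀ i, ContDiff ℝ ∞ (g i) := fun i =>
    (hf i).comp (ContinuousLinearMap.proj (R := ℝ) (φ := fun _ : Fin p => EuclideanSpace ℝ (Fin 4)) i).contDiff
  have hgb : ∀ i ∈ (Finset.univ : Finset (Fin p)), ∀ b ≤ N, ∀ y, ‖iteratedFDeriv ℝ b (g i) y‖ ≤ K ^ b := by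
    intro i _ b hb y
    have h' := ptuDeriv_geom_comp_clm _ (ptuDeriv_norm_piProj_le p i) (hf i) (h i) b hb y
    rwa [one_mul] at h'
  rw [hfun]
  refine ⟨contDiff_prod fun i _ => hgc i, fun b hb y => ?_⟩
  have h' := ptuDeriv_geom_prod Finset.univ (fun i _ => (hgc i).of_le (mod_cast le_top)) hK hgb b hb y
  rwa [Finset.card_univ, Fintype.card_fin] at h'

/-- The ramp arithmetic `2²² (N+1)²/(a (d/8)) = 2²⁵ (N+1)²/(a d)`. [folklore] -/
theorem ptuDeriv_ramp_eq (a d : ℝ) (N : ℕ) :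
    (2 : ℝ) ^ 22 * ((N : ℝ) + 1) ^ 2 / (a * (d / 8)) = 2 ^ 25 * ((N : ℝ) + 1) ^ 2 / (a * d) := by
  rw [show a * (d / 8) = a * d / 8 by ring, div_div_eq_mul_div]
  ring

/-- **The enlarged tensor bump `φ̃`**: values in `[0,1]` and `‖Dᵇ φ̃‖ ≤ (p · 2²⁵ (N+1)²/(a d))ᵇ` for `b ≤ N`.
[folklore] -/
theorem ptuDeriv_phiTilde_bound {a : ℝ} (ha : 0 < a) (m p : ℕ) (hd : 0 < ptuD m p) (v : Fin 4 → ℤ)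
    (z : Fin p → Fin 4 → ℤ) (N : ℕ) :
    (∀ y, 0 ≤ ptuPhiTilde a m p v z y ∧ ptuPhiTilde a m p v z y ≤ 1) ∧
      ∀ b ≤ N, ∀ y, ‖iteratedFDeriv ℝ b (ptuPhiTilde a m p v z) y‖ ≤
        ((p : ℝ) * (2 ^ 25 * ((N : ℝ) + 1) ^ 2 / (a * ptuD m p))) ^ b := by
  have hd' : (0 : ℝ) < ptuD m p := by exact_mod_cast hd
  have hw : 0 < a * ((ptuD m p : ℝ) / 8) := by positivity
  have hcut := fun i => ptuDeriv_cut_bound a ((ptuD m p : ℝ) / 8) hw m v (z i) 2 N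
  have hK : (0 : ℝ) ≤ 2 ^ 25 * ((N : ℝ) + 1) ^ 2 / (a * ptuD m p) := by positivity
  have h := ptuDeriv_tensor_bound (fun i => ptuChiTildeFun a m p v (z i)) (fun i => ptuCut_contDiff _ _ _ _ _ _) hK
    (N := N) (fun i b hb u => by
      have h' := (hcut i).2 b hb u
      rw [ptuDeriv_ramp_eq] at h'
      exact h')
  exact ⟨fun y => ptuDeriv_prod_mem Finset.univ
    (f := fun i (y : Fin p → EuclideanSpace ℝ (Fin 4)) => ptuChiTildeFun a m p v (z i) (y i))
    (fun i _ y => (hcut i).1 (y i)) y, h.2⟩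

/-- **The tensor bump `φ*`**: smooth, values in `[0,1]` and `‖Dᵇ φ*‖ ≤ (p · 2²⁵ (N+1)²/(a d))ᵇ` for `b ≤ N`.
[folklore] -/
theorem ptuDeriv_phiStar_bound {a : ℝ} (ha : 0 < a) (m p : ℕ) (hd : 0 < ptuD m p) (v : Fin 4 → ℤ)
    (z : Fin p → Fin 4 → ℤ) (N : ℕ) :
    ContDiff ℝ ∞ (ptuPhiStar a m p v z) ∧ (∀ y, 0 ≤ ptuPhiStar a m p v z y ∧ ptuPhiStar a m p v z y ≤ 1) ∧
      ∀ b ≤ N, ∀ y, ‖iteratedFDeriv ℝ b (ptuPhiStar a m p v z) y‖ ≤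
        ((p : ℝ) * (2 ^ 25 * ((N : ℝ) + 1) ^ 2 / (a * ptuD m p))) ^ b := by
  have hd' : (0 : ℝ) < ptuD m p := by exact_mod_cast hd
  have hw : 0 < a * ((ptuD m p : ℝ) / 8) := by positivity
  have hcut := fun i => ptuDeriv_cut_bound a ((ptuD m p : ℝ) / 8) hw m v (z i) (2 + (ptuD m p : ℝ) / 8) N
  have hK : (0 : ℝ) ≤ 2 ^ 25 * ((N : ℝ) + 1) ^ 2 / (a * ptuD m p) := by positivity
  have h := ptuDeriv_tensor_bound (fun i => ptuChiFun a m p v (z i)) (fun i => ptuCut_contDiff _ _ _ _ _ _) hK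
    (N := N) (fun i b hb u => by
      have h' := (hcut i).2 b hb u
      rw [ptuDeriv_ramp_eq] at h'
      exact h')
  exact ⟨h.1, fun y => ptuDeriv_prod_mem Finset.univ
    (f := fun i (y : Fin p → EuclideanSpace ℝ (Fin 4)) => ptuChiFun a m p v (z i) (y i))
    (fun i _ y => (hcut i).1 (y i)) y, h.2⟩

/-- The tensor bump `φ*` is smooth (no hypothesis). [folklore] -/
theorem ptuDeriv_phiStar_contDiff (a : ℝ) (m p : ℕ) (v : Fin 4 → ℤ) (z : Fin p → Fin 4 → ℤ) :
    ContDiff ℝ ∞ (ptuPhiStar a m p v z) := by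
  unfold ptuPhiStar ptuChiFun
  exact contDiff_prod fun i _ => (ptuCut_contDiff _ _ _ _ _ _).comp
    (ContinuousLinearMap.proj (R := ℝ) (φ := fun _ : Fin p => EuclideanSpace ℝ (Fin 4)) i).contDiff

/-! ## §2 The near weight -/

/-- The coordinate-difference functionals `y ↦ (yᵢ - yⱼ)_μ` have norm `≤ 2`. [folklore] -/
theorem ptuDeriv_norm_diffCoord_le (p : ℕ) (i j : Fin p) (μ : Fin 4) :
    ‖(EuclideanSpace.proj μ : EuclideanSpace ℝ (Fin 4) →L[ℝ] ℝ).comp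
        (ContinuousLinearMap.proj (R := ℝ) (φ := fun _ : Fin p => EuclideanSpace ℝ (Fin 4)) i -
          ContinuousLinearMap.proj (R := ℝ) (φ := fun _ : Fin p => EuclideanSpace ℝ (Fin 4)) j)‖ ≤ 2 := by
  refine (ContinuousLinearMap.opNorm_comp_le _ _).trans ?_
  have h1 := ptuDeriv_norm_proj_le μ
  have h2 : ‖ContinuousLinearMap.proj (R := ℝ) (φ := fun _ : Fin p => EuclideanSpace ℝ (Fin 4)) i -
      ContinuousLinearMap.proj (R := ℝ) (φ := fun _ : Fin p => EuclideanSpace ℝ (Fin 4)) j‖ ≤ 2 :=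
    (norm_sub_le _ _).trans (by linarith [ptuDeriv_norm_piProj_le p i, ptuDeriv_norm_piProj_le p j])
  calc _ ≤ 1 * 2 := mul_le_mul h1 h2 (norm_nonneg _) zero_le_one
    _ = 2 := one_mul 2

/-- **The near weight** (registered anchor): smooth, values in `[0,1]`, and for every target order `N`,
`‖Dᵇ ptuNear a p‖ ≤ (p² · 2²⁵ (N+1)²/(R a))ᵇ` for all `b ≤ N` (`R = ptuR p`). [folklore] -/
theorem ptuDeriv_near_bound : ∀ (a : ℝ) (p N : ℕ), 0 < a →
    ContDiff ℝ ∞ (ptuNear a p) ∧ (∀ y, 0 ≤ ptuNear a p y ∧ ptuNear a p y ≤ 1) ∧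
      ∀ b ≤ N, ∀ y, ‖iteratedFDeriv ℝ b (ptuNear a p) y‖ ≤
        ((p : ℝ) ^ 2 * (2 ^ 25 * ((N : ℝ) + 1) ^ 2 / ((ptuR p : ℝ) * a))) ^ b := by
  intro a p N ha
  set R : ℝ := (ptuR p : ℝ) * a with hR
  have hR0 : 0 < R := by
    rw [hR]; unfold ptuR; positivity
  set P : ℝ → ℝ := ptuPlateau (-R) R (R / 4) with hP
  set Lm : Fin p × Fin p → Fin 4 → (Fin p → EuclideanSpace ℝ (Fin 4)) →L[ℝ] ℝ := fun ij μ =>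
    (EuclideanSpace.proj μ : EuclideanSpace ℝ (Fin 4) →L[ℝ] ℝ).comp
      (ContinuousLinearMap.proj (R := ℝ) (φ := fun _ : Fin p => EuclideanSpace ℝ (Fin 4)) ij.1 -
        ContinuousLinearMap.proj (R := ℝ) (φ := fun _ : Fin p => EuclideanSpace ℝ (Fin 4)) ij.2) with hLm
  set F : Fin p × Fin p → Fin 4 → (Fin p → EuclideanSpace ℝ (Fin 4)) → ℝ := fun ij μ => P ∘ Lm ij μ with hF
  set Q : Fin p × Fin p → (Fin p → EuclideanSpace ℝ (Fin 4)) → ℝ := fun ij y => ∏ μ ∈ (Finset.univ : Finset (Fin 4)), F ij μ y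
    with hQ
  set G : Fin p × Fin p → (Fin p → EuclideanSpace ℝ (Fin 4)) → ℝ := fun ij y => 1 - Q ij y with hG
  set prs := (Finset.univ : Finset (Fin p × Fin p)).filter (fun ij => ij.1 < ij.2) with hprs
  set H : (Fin p → EuclideanSpace ℝ (Fin 4)) → ℝ := fun y => ∏ ij ∈ prs, G ij y with hH
  have hfun : ptuNear a p = fun y => 1 - H y := by
    funext y; rfl
  -- the factors
  have hPc : ContDiff ℝ ∞ P := ptuPlateau_contDiff _ _ _
  have hPb := ptuDeriv_plateau_bound (by positivity : 0 < R / 4) (-R) R N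
  have hK1 : (2 : ℝ) * (2 ^ 20 * ((N : ℝ) + 1) ^ 2 / (R / 4)) = 2 ^ 23 * ((N : ℝ) + 1) ^ 2 / R := by
    field_simp; ring
  have hFc : ∀ ij μ, ContDiff ℝ ∞ (F ij μ) := fun ij μ => hPc.comp (Lm ij μ).contDiff
  have hFb : ∀ ij μ, ∀ b ≤ N, ∀ y, ‖iteratedFDeriv ℝ b (F ij μ) y‖ ≤ ((2 : ℝ) ^ 23 * ((N : ℝ) + 1) ^ 2 / R) ^ b := by
    intro ij μ b hb y
    have h := ptuDeriv_geom_comp_clm (Lm ij μ) (ptuDeriv_norm_diffCoord_le p ij.1 ij.2 μ) hPc hPb b hb y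
    rwa [hK1] at h
  have hF01 : ∀ ij μ y, 0 ≤ F ij μ y ∧ F ij μ y ≤ 1 := fun ij μ y => ptuPlateau_mem _ _ _ _
  -- products over the four coordinates
  have hK2 : (0 : ℝ) ≤ 2 ^ 23 * ((N : ℝ) + 1) ^ 2 / R := by positivity
  have hQc : ∀ ij, ContDiff ℝ ∞ (Q ij) := fun ij => contDiff_prod fun μ _ => hFc ij μ
  have hQ01 : ∀ ij y, 0 ≤ Q ij y ∧ Q ij y ≤ 1 := fun ij y => ptuDeriv_prod_mem _ (fun μ _ y => hF01 ij μ y) y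
  have hQb : ∀ ij, ∀ b ≤ N, ∀ y, ‖iteratedFDeriv ℝ b (Q ij) y‖ ≤ ((2 : ℝ) ^ 25 * ((N : ℝ) + 1) ^ 2 / R) ^ b := by
    intro ij b hb y
    have h := ptuDeriv_geom_prod (Finset.univ : Finset (Fin 4)) (fun μ _ => (hFc ij μ).of_le (mod_cast le_top)) hK2
      (fun μ _ => hFb ij μ) b hb y
    rw [Finset.card_univ, Fintype.card_fin] at h
    refine h.trans (le_of_eq ?_)
    push_cast; ring
  -- complements
  have hGc : ∀ ij, ContDiff ℝ ∞ (G ij) := fun ij => contDiff_const.sub (hQc ij)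
  have hG := fun ij => ptuDeriv_geom_one_sub ((hQc ij).of_le (mod_cast le_top)) (hQ01 ij) (hQb ij)
  -- product over the pairs
  have hK3 : (0 : ℝ) ≤ 2 ^ 25 * ((N : ℝ) + 1) ^ 2 / R := by positivity
  have hHc : ContDiff ℝ ∞ H := contDiff_prod fun ij _ => hGc ij
  have hH01 : ∀ y, 0 ≤ H y ∧ H y ≤ 1 := fun y => ptuDeriv_prod_mem _ (fun ij _ y => (hG ij).1 y) y
  have hcard : (prs.card : ℝ) ≤ (p : ℝ) ^ 2 := by
    have h : prs.card ≤ p ^ 2 := by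
      refine (Finset.card_filter_le _ _).trans ?_
      rw [Finset.card_univ, Fintype.card_prod, Fintype.card_fin, sq]
    exact_mod_cast h
  have hHb : ∀ b ≤ N, ∀ y, ‖iteratedFDeriv ℝ b H y‖ ≤ ((p : ℝ) ^ 2 * (2 ^ 25 * ((N : ℝ) + 1) ^ 2 / R)) ^ b := by
    intro b hb y
    have h := ptuDeriv_geom_prod prs (fun ij _ => (hGc ij).of_le (mod_cast le_top)) hK3 (fun ij _ => (hG ij).2) b hb y
    exact h.trans (pow_le_pow_left₀ (by positivity) (mul_le_mul_of_nonneg_right hcard hK3) b)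
  have hnear := ptuDeriv_geom_one_sub (hHc.of_le (mod_cast le_top)) hH01 hHb
  rw [hfun]
  exact ⟨contDiff_const.sub hHc, hnear.1, hnear.2⟩

/-! ## §3 The outer weight -/

/-- The coordinate functionals `y ↦ yᵢμ` have norm `≤ 1`. [folklore] -/
theorem ptuDeriv_norm_coord_le (p : ℕ) (i : Fin p) (μ : Fin 4) :
    ‖(EuclideanSpace.proj μ : EuclideanSpace ℝ (Fin 4) →L[ℝ] ℝ).comp
        (ContinuousLinearMap.proj (R := ℝ) (φ := fun _ : Fin p => EuclideanSpace ℝ (Fin 4)) i)‖ ≤ 1 := by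
  refine (ContinuousLinearMap.opNorm_comp_le _ _).trans ?_
  calc _ ≤ (1 : ℝ) * 1 := mul_le_mul (ptuDeriv_norm_proj_le μ) (ptuDeriv_norm_piProj_le p i) (norm_nonneg _) zero_le_one
    _ = 1 := one_mul 1

/-- **The outer weight**: smooth, values in `[0,1]`, and `‖Dᵇ ptuOut a L p‖ ≤ (p · 2²⁵ (N+1)²/(a L))ᵇ` for `b ≤ N`
(`L ≥ 1`). [folklore] -/
theorem ptuDeriv_out_bound {a : ℝ} (ha : 0 < a) {L : ℕ} (hL : 1 ≤ L) (p N : ℕ) :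
    ContDiff ℝ ∞ (ptuOut a L p) ∧ (∀ y, 0 ≤ ptuOut a L p y ∧ ptuOut a L p y ≤ 1) ∧
      ∀ b ≤ N, ∀ y, ‖iteratedFDeriv ℝ b (ptuOut a L p) y‖ ≤
        ((p : ℝ) * (2 ^ 25 * ((N : ℝ) + 1) ^ 2 / (a * L))) ^ b := by
  have hL' : (0 : ℝ) < L := by exact_mod_cast hL
  have haL : 0 < a * (L : ℝ) := mul_pos ha hL'
  set P : ℝ → ℝ := ptuPlateau (-(a * (L : ℝ) / 4)) (a * (L : ℝ) / 4) (a * (L : ℝ) / 8) with hP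
  set Lo : Fin p → Fin 4 → (Fin p → EuclideanSpace ℝ (Fin 4)) →L[ℝ] ℝ := fun i μ =>
    (EuclideanSpace.proj μ : EuclideanSpace ℝ (Fin 4) →L[ℝ] ℝ).comp
      (ContinuousLinearMap.proj (R := ℝ) (φ := fun _ : Fin p => EuclideanSpace ℝ (Fin 4)) i) with hLo
  set F : Fin p → Fin 4 → (Fin p → EuclideanSpace ℝ (Fin 4)) → ℝ := fun i μ => P ∘ Lo i μ with hF
  set Q : Fin p → (Fin p → EuclideanSpace ℝ (Fin 4)) → ℝ := fun i y => ∏ μ ∈ (Finset.univ : Finset (Fin 4)), F i μ y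
    with hQ
  set H : (Fin p → EuclideanSpace ℝ (Fin 4)) → ℝ := fun y => ∏ i ∈ (Finset.univ : Finset (Fin p)), Q i y with hH
  have hfun : ptuOut a L p = fun y => 1 - H y := by
    funext y; rfl
  have hPc : ContDiff ℝ ∞ P := ptuPlateau_contDiff _ _ _
  have hPb := ptuDeriv_plateau_bound (by positivity : 0 < a * (L : ℝ) / 8) (-(a * (L : ℝ) / 4)) (a * (L : ℝ) / 4) N
  have hK1 : (1 : ℝ) * (2 ^ 20 * ((N : ℝ) + 1) ^ 2 / (a * (L : ℝ) / 8)) = 2 ^ 23 * ((N : ℝ) + 1) ^ 2 / (a * L) := by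
    field_simp; ring
  have hFc : ∀ i μ, ContDiff ℝ ∞ (F i μ) := fun i μ => hPc.comp (Lo i μ).contDiff
  have hFb : ∀ i μ, ∀ b ≤ N, ∀ y, ‖iteratedFDeriv ℝ b (F i μ) y‖ ≤ ((2 : ℝ) ^ 23 * ((N : ℝ) + 1) ^ 2 / (a * L)) ^ b := by
    intro i μ b hb y
    have h := ptuDeriv_geom_comp_clm (Lo i μ) (ptuDeriv_norm_coord_le p i μ) hPc hPb b hb y
    rwa [hK1] at h
  have hF01 : ∀ i μ y, 0 ≤ F i μ y ∧ F i μ y ≤ 1 := fun i μ y => ptuPlateau_mem _ _ _ _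
  have hK2 : (0 : ℝ) ≤ 2 ^ 23 * ((N : ℝ) + 1) ^ 2 / (a * L) := by positivity
  have hQc : ∀ i, ContDiff ℝ ∞ (Q i) := fun i => contDiff_prod fun μ _ => hFc i μ
  have hQ01 : ∀ i y, 0 ≤ Q i y ∧ Q i y ≤ 1 := fun i y => ptuDeriv_prod_mem _ (fun μ _ y => hF01 i μ y) y
  have hQb : ∀ i, ∀ b ≤ N, ∀ y, ‖iteratedFDeriv ℝ b (Q i) y‖ ≤ ((2 : ℝ) ^ 25 * ((N : ℝ) + 1) ^ 2 / (a * L)) ^ b := by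
    intro i b hb y
    have h := ptuDeriv_geom_prod (Finset.univ : Finset (Fin 4)) (fun μ _ => (hFc i μ).of_le (mod_cast le_top)) hK2
      (fun μ _ => hFb i μ) b hb y
    rw [Finset.card_univ, Fintype.card_fin] at h
    refine h.trans (le_of_eq ?_)
    push_cast; ring
  have hK3 : (0 : ℝ) ≤ 2 ^ 25 * ((N : ℝ) + 1) ^ 2 / (a * L) := by positivity
  have hHc : ContDiff ℝ ∞ H := contDiff_prod fun i _ => hQc i
  have hH01 : ∀ y, 0 ≤ H y ∧ H y ≤ 1 := fun y => ptuDeriv_prod_mem _ (fun i _ y => hQ01 i y) y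
  have hHb : ∀ b ≤ N, ∀ y, ‖iteratedFDeriv ℝ b H y‖ ≤ ((p : ℝ) * (2 ^ 25 * ((N : ℝ) + 1) ^ 2 / (a * L))) ^ b := by
    intro b hb y
    have h := ptuDeriv_geom_prod (Finset.univ : Finset (Fin p)) (fun i _ => (hQc i).of_le (mod_cast le_top)) hK3
      (fun i _ => hQb i) b hb y
    rwa [Finset.card_univ, Fintype.card_fin] at h
  have hout := ptuDeriv_geom_one_sub (hHc.of_le (mod_cast le_top)) hH01 hHb
  rw [hfun]
  exact ⟨contDiff_const.sub hHc, hout.1, hout.2⟩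

end Summit.QuantumFields.YangMills.Theorems.ContinuumLegGivenGap

end
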